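import Literature.NumberTheory.ComplexMultiplication.PrimitiveCMPairsClassificationComplex
import HarnessLib

/-!
# The torus `T^Ψ` of a `Γ`-orbit `Ψ` of CM-types on `ℚ^{cm}` and its canonical character `t^Ψ`
# (Milne 1999, *Lefschetz motives and the Tate conjecture*, §2), as a `Γ`-character module

Layer `Literature/NumberTheory/ComplexMultiplication` (lane `lit-hodgefound`; DAG-B node B5-07, the object `(T^Ψ, t^Ψ)`
recorded there as missing: «the torus `T^Ψ` as a named object: still —»).  Milne defines the torus `T^Ψ` over `ℚ`
THROUGH ITS CHARACTER GROUP, a `Γ`-module; this file formalises exactly that character group with its `Γ`-action and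
the distinguished element `t^Ψ`, proves the two assertions printed after the definition (independence of `ψ`,
`Γ`-invariance), and proves the combinatorial identification in the proof of Prop. 2.5 (`Hom(E_ψ, ℚ^{al}) ≅ Ψ`,
`X*(L(A_Ψ)) ≅ X*(T^Ψ)`, `l ↦ t`).  Definitions with bodies (`OrbitTorus.aug`, `act`, `rel`, `CharModule`, `actQ`,
`rep`, `tChar`, `transfer`, `congr`; `CMNumbers.torusChar`, `torusRep`, `tTorus`, `homCharModule`, `lChar`, `homEquivOrbit`,
`homCharModuleEquiv`); everything else proved; no named fact; the torus as a group scheme over `ℚ` is NOT constructed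
(the tree has no diagonalizable group schemes; as for the Serre group of `SerreGroupCharacters`, the character module
is the carrier).

THE PRINT.  J. S. Milne, *Lefschetz motives and the Tate conjecture*, Compositio Math. 117 (1999) 45–76 (held text
`paper:doi-10-1023-a-1000776613765`; printed page = PDF page + 44):

> (p. 55, L38–L48) For a `Γ`-orbit `Ψ` of CM-types on `ℚ^{cm}`, define `T^Ψ` to be the torus over `ℚ` with character
> group `X*(T^Ψ) = {f : Ψ → ℤ} / {f | f = ιf and Σ_ψ f(ψ) = 0}`.  The element `ψ + ιψ` of `X*(T^Ψ)` is independent of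
> the choice of `ψ ∈ Ψ` and is fixed by `Γ`.  It therefore defines a homomorphism `t^Ψ : T^Ψ → 𝔾_m` rational over `ℚ`.
> (p. 56, L8–L22) PROPOSITION 2.5. For any `Ψ`, `(L(A_Ψ), l(A_Ψ)) = (T^Ψ, t^Ψ)`.  Proof. Choose a `ψ ∈ Ψ`. Let
> `(E_ψ, φ_ψ)` be as in the proof of Proposition 2.2 […] Then `L(A_Ψ)` is the subtorus of `(𝔾_m)_{E_ψ/ℚ}` such that
> `L(A_Ψ)(ℚ) = {α ∈ E_ψ^× | α · ια ∈ ℚ^×}` and its canonical character `l(A_Ψ)` sends `α` to `α · ια`.  Therefore,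
> `X*(L(A_Ψ))` is the quotient of `ℤ^{Hom(E_ψ, ℚ^{al})}` by the subgroup of `f` such that `f(τ) = f(ιτ)` for all
> `τ : E_ψ → ℚ^{al}` and `Σ f(τ) = 0`, and `l(A_Ψ)` is represented by `ι + 1`.  By definition, `Hom(E_ψ, ℚ^{al}) = Γ/Γ_ψ`
> where `Γ_ψ` is the group fixing `ψ`, and `σ ↦ σψ` is a bijection from `Γ/Γ_ψ` onto `Ψ`.  This map identifies
> `X*(L(A_Ψ))` with `X*(T^Ψ)` and `l(A_Ψ)` with `t^Ψ`.

## Model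

* `Γ = Gal(ℚ^{al}/ℚ)` acts on the CM-types on `ℚ^{cm}` through `Gal(ℚ^{cm}/ℚ) = (cmNumbers ≃ₐ[ℚ] cmNumbers)`
  (`PrimitiveCMPairsClassification` §11: carrier `CMNumbers.GalCMType`, `CMNumbers.range_galRestrict_smul`);
  `ι = cmNumbersConj` is central (`cmNumbersConj_mul_comm`) of order two (`cmNumbersConj_mul_self`), so `ψ ↦ ιψ` is the
  action of the element `ι ∈ Γ` on the orbit `Ψ`.
* An orbit `Ψ` is the `Γ`-set `↥(MulAction.orbit Γ Ψ₀)` of a CM-type `Ψ₀`; `{f : Ψ → ℤ}` is the free module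
  `Ψ →₀ R` on `Ψ` (the orbit is finite — `Γ/Γ_ψ = Hom(E_ψ, ℚ^{al})` — so finitely supported functions are all functions;
  the finsupp form needs no finiteness bookkeeping), with COEFFICIENTS in an arbitrary commutative ring `R` — the printed
  lattice is `R = ℤ` (`torusChar ℤ Ψ₀`), and `R`-coefficients give `X*(T^Ψ) ⊗ R` at no cost while keeping the `R`-module
  structure of the quotient canonical; `Σ_ψ f(ψ)` is the augmentation `OrbitTorus.aug`, `ιf` is the translate
  `OrbitTorus.act ι f`, and `X*(T^Ψ)` is the quotient module `OrbitTorus.CharModule` with the induced `Γ`-representation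
  `OrbitTorus.rep` (a `Representation R Γ`); `t^Ψ = OrbitTorus.tChar ι ψ = [δ_ψ + δ_{ιψ}]`.
* The general construction `OrbitTorus.*` is made for ANY group `G` acting on a type `S` with a chosen `ι ∈ G` (central
  of square one where needed), so that it serves both `S = Ψ` and `S = Hom_ℚ(E_ψ, ℚ^{cm})` (`Γ` acting by composition,
  the scoped `algEquivCompAction`), the index set of `X*((𝔾_m)_{E_ψ/ℚ}) = ℤ^{Hom(E_ψ, ℚ^{al})}`; the
  identification of Prop. 2.5 is transport along the `Γ`-equivariant bijection `τ ↦ ψ_τ` (`CMNumbers.homEquivOrbit`).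

## What is proved

* §1 (`OrbitTorus`, general `R`, `G`, `S`, `ι`): `aug`, `act` (`act_one`, `act_mul`, `aug_act`), `rel` =
  `{f | ιf = f ∧ Σ f = 0}` (`mem_rel_iff`), `CharModule R S ι = R[S]/rel`, the induced action `actQ` /
  **`rep : Representation R G (CharModule R S ι)`**
  (for `ι` central: `act_mem_rel`), **`tChar ι s₀ = [δ_{s₀} + δ_{ιs₀}]`**, **`tChar_eq`** («independent of the choice of
  `ψ ∈ Ψ`», for `ι² = 1`) and **`rep_tChar`** («fixed by `Γ`»).
* §2 transport: a `G`-equivariant bijection `e : S ≃ S′` induces **`congr : CharModule R S ι ≃ₗ[R] CharModule R S′ ι`**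
  (`transfer = Finsupp.domLCongr` on the quotients) with `congr_mk`, **`congr_tChar`** (`t ↦ t`) and **`congr_rep`**
  (`G`-equivariant).
* §3 `ℚ^{cm}`: **`CMNumbers.torusChar R Ψ₀ = X*(T^Ψ) ⊗ R`** for the orbit `Ψ` of a CM-type `Ψ₀` (`R = ℤ`: `X*(T^Ψ)`), its
  `Γ`-representation `torusRep`, **`tTorus R Ψ₀ = t^Ψ`** with the printed assertions `tTorus_eq_tChar` (any `ψ ∈ Ψ`) and
  `torusRep_tTorus` (`Γ`-fixed); `conj_smul_mem_orbit` (`ιψ ∈ Ψ`).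
* §4 Prop. 2.5's identification for a PRIMITIVE CM-pair `(E, Φ, ρ)` valued in `ℚ^{cm}` (`Φ ⊆ Hom_ℚ(E, ℚ^{cm})` a CM
  type, `IsPrimitive Γ Φ ρ`, `ψ = ψ_ρ`): **`stabilizer_psiType_eq`** (`Γ_ψ = ` the group fixing `ρ(E)`, i.e.
  «`Hom(E_ψ, ℚ^{al}) = Γ/Γ_ψ`»), **`psiType_injective`**, **`homEquivOrbit : Hom_ℚ(E, ℚ^{cm}) ≃ Ψ`, `τ ↦ ψ_τ`** («a
  bijection from `Γ/Γ_ψ` onto `Ψ`»; `Γ`-equivariant, `homEquivOrbit_smul`), the character module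
  `homCharModule R E = R^{Hom(E, ℚ^{al})}/{f = fι, Σ f = 0}` with `lChar R ρ = [ι + 1]` («`l(A_Ψ)` is represented by
  `ι + 1`»), and **`homCharModuleEquiv : homCharModule R E ≃ₗ[R] torusChar R ψ_ρ`** with
  **`homCharModuleEquiv_lChar : l ↦ t^Ψ`** and
  `homCharModuleEquiv_rep` (`Γ`-equivariant) — «This map identifies `X*(L(A_Ψ))` with `X*(T^Ψ)` and `l(A_Ψ)` with
  `t^Ψ`».  The abelian-variety content of Prop. 2.5 — `L(A_Ψ)(ℚ) = {α | α · ια ∈ ℚ^×}`, `l(α) = α · ια` — is the tree's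
  `Milne1999/LefschetzCentraliserCM` (`IsCMTypeRealisation.mem_similitudeCentralizerGroup_iff_exists_rat`,
  `polarizationPairingOne_theta_theta`) and is not restated.

## References

* [Milne1999] J. S. Milne, *Lefschetz motives and the Tate conjecture*, Compositio Math. 117 (1999) 45–76, §2
  p. 55 L38–L48 (definition of `T^Ψ`, `t^Ψ`), p. 56 Prop. 2.5 with proof.
* [MilneCM2006] J. S. Milne, *Complex Multiplication* (course notes; v0.10, 2020), Ch. I §1 Lemma 1.29, Prop. 1.30
  (pp. 18–19) — `ψ_ρ`, through `PrimitiveCMPairsClassification`.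
-/

noncomputable section

open scoped Pointwise

namespace Literature.NumberTheory.ComplexMultiplication

/-! ## §1 The character module `R[S]/{f = ιf, Σ f = 0}` of a `G`-set with a distinguished central `ι` -/

namespace OrbitTorus

/- Coefficients: the printed object is the `ℤ`-lattice `X*(T^Ψ)` (`R = ℤ`); the construction is made over an arbitrary
commutative ring `R` of coefficients (`X*(T^Ψ) ⊗ R`), which costs nothing and keeps the `R`-module structure on the
quotient canonical (for `R = ℤ` use `OrbitTorus.CharModule ℤ`). -/

section General

variable (R : Type*) [CommRing R] {G : Type*} [Group G] {S : Type*} [MulAction G S] (ι : G)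

/-- The augmentation `f ↦ Σ_s f(s)` on `R[S] = (S →₀ R)` («`Σ_ψ f(ψ)`»). [cite: Milne1999, §2 p. 55 L38–L45] -/
def aug : (S →₀ R) →ₗ[R] R :=
  Finsupp.linearCombination R fun _ : S ↦ (1 : R)

/-- [cite: Milne1999, §2 p. 55 L38–L45] -/
@[simp] theorem aug_single (s : S) (r : R) : aug R (Finsupp.single s r) = r := by
  simp [aug, Finsupp.linearCombination_single]

/-- The translate `gf` of `f ∈ R[S]` (`(gf)(s) = f(g⁻¹s)`, i.e. `δ_s ↦ δ_{gs}`); for `g = ι` this is Milne's `ιf`.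
[cite: Milne1999, §2 p. 55 L38–L47] -/
def act (g : G) : (S →₀ R) →ₗ[R] (S →₀ R) :=
  Finsupp.lmapDomain R R (g • · : S → S)

/-- [cite: Milne1999, §2 p. 55 L38–L47] -/
@[simp] theorem act_single (g : G) (s : S) (r : R) : act R g (Finsupp.single s r) = Finsupp.single (g • s) r := by
  simp [act, Finsupp.lmapDomain_apply, Finsupp.mapDomain_single]

/-- `1f = f`. [cite: Milne1999, §2 p. 55 L38–L47] -/
theorem act_one : act R (1 : G) = (LinearMap.id : (S →₀ R) →ₗ[R] (S →₀ R)) := by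
  rw [act, show (fun s : S ↦ (1 : G) • s) = _root_.id from funext fun s ↦ one_smul G s, Finsupp.lmapDomain_id]

/-- `(gh)f = g(hf)`. [cite: Milne1999, §2 p. 55 L38–L47] -/
theorem act_mul (g h : G) : act R (g * h) = (act R g).comp (act R h : (S →₀ R) →ₗ[R] (S →₀ R)) := by
  rw [act, act, act, show (fun s : S ↦ (g * h) • s) = (g • · : S → S) ∘ (h • · : S → S) from
    funext fun s ↦ mul_smul g h s, Finsupp.lmapDomain_comp]

/-- Translation preserves the augmentation. [cite: Milne1999, §2 p. 55 L38–L47] -/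
@[simp] theorem aug_act (g : G) (f : S →₀ R) : aug R (act R g f) = aug R f := by
  rw [act, Finsupp.lmapDomain_apply, aug, Finsupp.linearCombination_mapDomain]
  rfl

variable (S) in
/-- **The relation module `{f | f = ιf and Σ f = 0}`.** [cite: Milne1999, §2 p. 55 L38–L45] -/
def rel : Submodule R (S →₀ R) :=
  LinearMap.ker (act R ι - LinearMap.id) ⊓ LinearMap.ker (aug R : (S →₀ R) →ₗ[R] R)

/-- Unfolding `rel`: `f ∈ rel ↔ ιf = f ∧ Σ f = 0`. [cite: Milne1999, §2 p. 55 L38–L45] -/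
theorem mem_rel_iff (f : S →₀ R) : f ∈ rel R S ι ↔ act R ι f = f ∧ aug R f = 0 := by
  simp [rel, sub_eq_zero]

variable (S) in
/-- **The character module `X = {f : S → R}/{f = ιf, Σ f = 0}`** (for `S = Ψ` a `Γ`-orbit of CM-types on `ℚ^{cm}` and
`R = ℤ`: Milne's `X*(T^Ψ)`; for `S = Hom(E_ψ, ℚ^{al})`: his `X*(L(A_Ψ))`). [cite: Milne1999, §2 p. 55 L38–L45] -/
abbrev CharModule : Type _ :=
  (S →₀ R) ⧸ rel R S ι

/-- For `ι` central, the relation module is `G`-stable. [cite: Milne1999, §2 p. 55 L45–L47 («fixed by `Γ`»)] -/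
theorem act_mem_rel (hc : ∀ g : G, ι * g = g * ι) (g : G) {f : S →₀ R} (hf : f ∈ rel R S ι) :
    act R g f ∈ rel R S ι := by
  rw [mem_rel_iff] at hf ⊢
  refine ⟨?_, by rw [aug_act, hf.2]⟩
  rw [← LinearMap.comp_apply, ← act_mul, hc g, act_mul, LinearMap.comp_apply, hf.1]

/-- `rel ≤ g⁻¹(rel)`, the hypothesis of `Submodule.mapQ`. [cite: Milne1999, §2 p. 55 L45–L47] -/
theorem rel_le_comap_act (hc : ∀ g : G, ι * g = g * ι) (g : G) :
    rel R S ι ≤ (rel R S ι).comap (act R g : (S →₀ R) →ₗ[R] (S →₀ R)) :=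
  fun _ hf ↦ Submodule.mem_comap.mpr (act_mem_rel R ι hc g hf)

variable (S) in
/-- The action of `g ∈ G` on the character module (for `ι` central). [cite: Milne1999, §2 p. 55 L45–L47] -/
def actQ (hc : ∀ g : G, ι * g = g * ι) (g : G) : CharModule R S ι →ₗ[R] CharModule R S ι :=
  Submodule.mapQ (rel R S ι) (rel R S ι) (act R g) (rel_le_comap_act R ι hc g)

/-- [cite: Milne1999, §2 p. 55 L45–L47] -/
@[simp] theorem actQ_mk (hc : ∀ g : G, ι * g = g * ι) (g : G) (f : S →₀ R) :
    actQ R S ι hc g (Submodule.Quotient.mk f) = Submodule.Quotient.mk (act R g f) :=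
  rfl

variable (S) in
/-- **The `G`-module structure of the character module** (the character group of a torus over `ℚ` is a
`Γ`-module): `g[f] = [gf]`. [cite: Milne1999, §2 p. 55 L38–L47] -/
def rep (hc : ∀ g : G, ι * g = g * ι) : Representation R G (CharModule R S ι) where
  toFun := actQ R S ι hc
  map_one' := Submodule.linearMap_qext _ (LinearMap.ext fun f ↦ by
    rw [LinearMap.comp_apply, LinearMap.comp_apply, Submodule.mkQ_apply, actQ_mk, act_one]
    rfl)
  map_mul' g h := Submodule.linearMap_qext _ (LinearMap.ext fun f ↦ by
    rw [LinearMap.comp_apply, LinearMap.comp_apply, Submodule.mkQ_apply, actQ_mk, act_mul]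
    rfl)

/-- [cite: Milne1999, §2 p. 55 L45–L47] -/
@[simp] theorem rep_mk (hc : ∀ g : G, ι * g = g * ι) (g : G) (f : S →₀ R) :
    rep R S ι hc g (Submodule.Quotient.mk f) = Submodule.Quotient.mk (act R g f) :=
  rfl

/-- **The element `t = [δ_{s₀} + δ_{ιs₀}]`** («the element `ψ + ιψ` of `X*(T^Ψ)`»; on `Hom(E_ψ, ℚ^{al})`: «`ι + 1`»).
[cite: Milne1999, §2 p. 55 L45–L48] -/
def tChar (s₀ : S) : CharModule R S ι :=
  Submodule.Quotient.mk (Finsupp.single s₀ 1 + Finsupp.single (ι • s₀) 1)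

/-- **«The element `ψ + ιψ` is independent of the choice of `ψ ∈ Ψ`»** (indeed of `s₀ ∈ S`, for `ι² = 1`: the
difference `δ_s + δ_{ιs} − δ_{s'} − δ_{ιs'}` is `ι`-invariant of augmentation `0`). [cite: Milne1999, §2 p. 55 L45–L47] -/
theorem tChar_eq (hι : ι * ι = 1) (s₀ s : S) : tChar R ι s₀ = tChar R ι s := by
  rw [tChar, tChar, Submodule.Quotient.eq, mem_rel_iff]
  constructor
  · simp only [map_sub, map_add, act_single, smul_smul, hι, one_smul]
    abel
  · simp only [map_sub, map_add, aug_single, sub_self]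

/-- **«… and is fixed by `Γ`»**: `g · t = t` for every `g` (for `ι` central of square one: `g(δ_s + δ_{ιs}) =
δ_{gs} + δ_{ι(gs)}`). [cite: Milne1999, §2 p. 55 L45–L47] -/
theorem rep_tChar (hc : ∀ g : G, ι * g = g * ι) (hι : ι * ι = 1) (g : G) (s₀ : S) :
    rep R S ι hc g (tChar R ι s₀) = tChar R ι s₀ := by
  rw [tChar, rep_mk, map_add, act_single, act_single, smul_smul, ← hc g, ← smul_smul]
  exact tChar_eq R ι hι (g • s₀) s₀

/-- **`t ≠ 0`** as soon as `2 ≠ 0` in `R` (e.g. `R = ℤ`): the representative `δ_{s₀} + δ_{ιs₀}` has augmentation `2`,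
while the relation module sits inside the augmentation kernel — so the character module is not zero and `t^Ψ` is a
non-trivial character. [cite: Milne1999, §2 p. 55 L45–L48] -/
theorem tChar_ne_zero (h2 : (2 : R) ≠ 0) (s₀ : S) : tChar R ι s₀ ≠ 0 := fun h ↦ h2 (by
  have hm := (Submodule.Quotient.mk_eq_zero (rel R S ι)).mp h
  rw [mem_rel_iff] at hm
  have h' := hm.2
  rwa [map_add, aug_single, aug_single, one_add_one_eq_two] at h')

end General

/-! ## §2 Transport along an equivariant bijection of `G`-sets -/

section Transport

variable (R : Type*) [CommRing R] {G : Type*} [Group G] {S : Type*} [MulAction G S] {S' : Type*} [MulAction G S']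
  (ι : G) (e : S ≃ S') (he : ∀ (g : G) (s : S), e (g • s) = g • e s)

/-- Relabelling `R[S] ≃ R[S′]` along a bijection `e : S ≃ S′` (`δ_s ↦ δ_{e s}`; Mathlib's `Finsupp.domLCongr`).
[cite: Milne1999, §2 p. 56 L19–L22] -/
def transfer : (S →₀ R) ≃ₗ[R] (S' →₀ R) :=
  Finsupp.domLCongr e

/-- [cite: Milne1999, §2 p. 56 L19–L22] -/
@[simp] theorem transfer_single (s : S) (r : R) : transfer R e (Finsupp.single s r) = Finsupp.single (e s) r :=
  Finsupp.domLCongr_single e s r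

/-- [cite: Milne1999, §2 p. 56 L19–L22] -/
@[simp] theorem transfer_symm_apply (f' : S' →₀ R) : (transfer R e).symm f' = transfer R e.symm f' :=
  rfl

include he in
/-- An equivariant relabelling commutes with the translations. [cite: Milne1999, §2 p. 56 L19–L22] -/
theorem transfer_act (g : G) (f : S →₀ R) : transfer R e (act R g f) = act R g (transfer R e f) := by
  induction f using Finsupp.induction_linear with
  | zero => simp
  | add f₁ f₂ h₁ h₂ => simp only [map_add, h₁, h₂]
  | single s n => rw [act_single, transfer_single, transfer_single, act_single, he]

/-- Relabelling preserves the augmentation. [cite: Milne1999, §2 p. 56 L19–L22] -/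
@[simp] theorem aug_transfer (f : S →₀ R) : aug R (transfer R e f) = aug R f := by
  induction f using Finsupp.induction_linear with
  | zero => simp
  | add f₁ f₂ h₁ h₂ => simp only [map_add, h₁, h₂]
  | single s n => rw [transfer_single, aug_single, aug_single]

include he in
/-- An equivariant bijection carries the relation module into the relation module.
[cite: Milne1999, §2 p. 56 L19–L22] -/
theorem transfer_mem_rel {f : S →₀ R} (hf : f ∈ rel R S ι) : transfer R e f ∈ rel R S' ι := by
  rw [mem_rel_iff] at hf ⊢
  exact ⟨by rw [← transfer_act R e he, hf.1], by rw [aug_transfer, hf.2]⟩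

include he in
/-- The inverse of an equivariant bijection is equivariant. [folklore] -/
private theorem symm_smul (g : G) (s' : S') : e.symm (g • s') = g • e.symm s' :=
  e.injective (by rw [he, e.apply_symm_apply, e.apply_symm_apply])

include he in
/-- … onto the relation module. [cite: Milne1999, §2 p. 56 L19–L22] -/
theorem map_rel_eq : (rel R S ι).map (transfer R e).toLinearMap = rel R S' ι := by
  refine le_antisymm (Submodule.map_le_iff_le_comap.mpr fun f hf ↦ transfer_mem_rel R ι e he hf) fun f' hf' ↦ ?_
  refine Submodule.mem_map.mpr ⟨transfer R e.symm f', transfer_mem_rel R ι e.symm (symm_smul e he) hf', ?_⟩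
  rw [LinearEquiv.coe_coe, ← transfer_symm_apply]
  exact (transfer R e).apply_symm_apply f'

/-- **Transport of the character module along an equivariant bijection** `e : S ≃ S′` («This map identifies
`X*(L(A_Ψ))` with `X*(T^Ψ)`»). [cite: Milne1999, §2 p. 56 L19–L22] -/
def congr : CharModule R S ι ≃ₗ[R] CharModule R S' ι :=
  Submodule.Quotient.equiv (rel R S ι) (rel R S' ι) (transfer R e) (map_rel_eq R ι e he)

/-- [cite: Milne1999, §2 p. 56 L19–L22] -/
@[simp] theorem congr_mk (f : S →₀ R) :
    congr R ι e he (Submodule.Quotient.mk f) = Submodule.Quotient.mk (transfer R e f) :=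
  rfl

/-- **`t ↦ t`** under transport («… and `l(A_Ψ)` with `t^Ψ`»). [cite: Milne1999, §2 p. 56 L19–L22] -/
theorem congr_tChar (s₀ : S) : congr R ι e he (tChar R ι s₀) = tChar R ι (e s₀) := by
  rw [tChar, congr_mk, map_add, transfer_single, transfer_single, he]
  rfl

/-- Transport is `G`-equivariant. [cite: Milne1999, §2 p. 56 L19–L22] -/
theorem congr_rep (hc : ∀ g : G, ι * g = g * ι) (g : G) (x : CharModule R S ι) :
    congr R ι e he (rep R S ι hc g x) = rep R S' ι hc g (congr R ι e he x) := by
  induction x using Submodule.Quotient.induction_on with | H f => ?_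
  rw [rep_mk, congr_mk, congr_mk, rep_mk, transfer_act R e he]

end Transport

end OrbitTorus

/-! ## §3 `ℚ^{cm}`: the torus `T^Ψ` of a `Γ`-orbit of CM-types and its canonical character `t^Ψ` -/

namespace CMNumbers

open _root_.NumberField Literature.NumberTheory.NumberFields

variable (R : Type*) [CommRing R]

/-- `ιψ ∈ Ψ`: complex conjugation `ι = cmNumbersConj ∈ Γ` preserves every `Γ`-orbit of CM-types on `ℚ^{cm}` (it acts as
an element of `Γ`). [cite: Milne1999, §2 p. 55 L38–L45] -/
theorem conj_smul_mem_orbit {Ψ₀ : GalCMType} {ψ : GalCMType} (hψ : ψ ∈ MulAction.orbit (cmNumbers ≃ₐ[ℚ] cmNumbers) Ψ₀) :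
    cmNumbersConj • ψ ∈ MulAction.orbit (cmNumbers ≃ₐ[ℚ] cmNumbers) Ψ₀ := by
  obtain ⟨τ, rfl⟩ := hψ
  exact ⟨cmNumbersConj * τ, mul_smul _ _ _⟩

/-- **`X*(T^Ψ)`, the character module of the torus `T^Ψ`** of the `Γ`-orbit `Ψ = Γ • Ψ₀` of a CM-type `Ψ₀` on `ℚ^{cm}`:
`{f : Ψ → ℤ}/{f | f = ιf and Σ_ψ f(ψ) = 0}`, `ι = cmNumbersConj`, with coefficients extended to `R` (`R = ℤ` is the printed
lattice). [cite: Milne1999, §2 p. 55 L38–L45] -/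
abbrev torusChar (Ψ₀ : GalCMType) : Type _ :=
  OrbitTorus.CharModule R (MulAction.orbit (cmNumbers ≃ₐ[ℚ] cmNumbers) Ψ₀) cmNumbersConj

/-- **`X*(T^Ψ)` as a `Γ`-module** (`Γ` acting through `Gal(ℚ^{cm}/ℚ)`; `ι` is central, `cmNumbersConj_mul_comm`).
[cite: Milne1999, §2 p. 55 L38–L47] -/
def torusRep (Ψ₀ : GalCMType) : Representation R (cmNumbers ≃ₐ[ℚ] cmNumbers) (torusChar R Ψ₀) :=
  OrbitTorus.rep R _ cmNumbersConj cmNumbersConj_mul_comm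

/-- **`t^Ψ ∈ X*(T^Ψ)`, the canonical character**: the class of `ψ + ιψ` (at the base point `Ψ₀` of the orbit).
[cite: Milne1999, §2 p. 55 L45–L48] -/
def tTorus (Ψ₀ : GalCMType) : torusChar R Ψ₀ :=
  OrbitTorus.tChar R cmNumbersConj (⟨Ψ₀, MulAction.mem_orbit_self Ψ₀⟩ : MulAction.orbit (cmNumbers ≃ₐ[ℚ] cmNumbers) Ψ₀)

/-- **«The element `ψ + ιψ` of `X*(T^Ψ)` is independent of the choice of `ψ ∈ Ψ`.»**
[cite: Milne1999, §2 p. 55 L45–L47] -/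
theorem tTorus_eq_tChar (Ψ₀ : GalCMType) (ψ : MulAction.orbit (cmNumbers ≃ₐ[ℚ] cmNumbers) Ψ₀) :
    tTorus R Ψ₀ = OrbitTorus.tChar R cmNumbersConj ψ :=
  OrbitTorus.tChar_eq R cmNumbersConj cmNumbersConj_mul_self _ ψ

/-- **«… and is fixed by `Γ`.»** [cite: Milne1999, §2 p. 55 L45–L47] -/
theorem torusRep_tTorus (Ψ₀ : GalCMType) (σ : cmNumbers ≃ₐ[ℚ] cmNumbers) :
    torusRep R Ψ₀ σ (tTorus R Ψ₀) = tTorus R Ψ₀ :=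
  OrbitTorus.rep_tChar R cmNumbersConj cmNumbersConj_mul_comm cmNumbersConj_mul_self σ _

/-- `t^Ψ ≠ 0` whenever `2 ≠ 0` in the coefficient ring (so for the printed lattice, `R = ℤ`).
[cite: Milne1999, §2 p. 55 L45–L48] -/
theorem tTorus_ne_zero (h2 : (2 : R) ≠ 0) (Ψ₀ : GalCMType) : tTorus R Ψ₀ ≠ 0 :=
  OrbitTorus.tChar_ne_zero R cmNumbersConj h2 _

/-- In particular over `ℤ`. [cite: Milne1999, §2 p. 55 L45–L48] -/
theorem tTorus_int_ne_zero (Ψ₀ : GalCMType) : tTorus ℤ Ψ₀ ≠ 0 :=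
  tTorus_ne_zero ℤ (by decide) Ψ₀

/-! ## §4 Proposition 2.5's identification: `Hom(E_ψ, ℚ^{al}) = Γ/Γ_ψ ≅ Ψ`, `X*(L(A_Ψ)) ≅ X*(T^Ψ)`, `l ↦ t` -/

section Primitive

variable {K : Type*} [Field K] [Algebra ℚ K] [FiniteDimensional ℚ K] {Φ : Set (K →ₐ[ℚ] cmNumbers)}
  (hΦ : ∀ φ, φ ∈ Φ ↔ cmNumbersConj • φ ∉ Φ)

/-- The `ψ`-type of the CM-pair `(E, Φ)` valued in `ℚ^{cm}` at `τ`, as a CM-type on `ℚ^{cm}` (Lemma 1.29 on `ℚ^{cm}`,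
`isCMTypeOn_psiType`). [cite: Milne1999, §2 p. 54 L38–L42] -/
def psiGal (τ : K →ₐ[ℚ] cmNumbers) : GalCMType :=
  ⟨psiType Φ τ, isCMTypeOn_psiType hΦ τ⟩

/-- [cite: Milne1999, §2 p. 54 L38–L42] -/
@[simp] theorem coe_psiGal (τ : K →ₐ[ℚ] cmNumbers) : (psiGal hΦ τ).1 = psiType Φ τ :=
  rfl

/-- `ψ_{στ} = σψ_τ` («`ψ_{ρ∘τ}(σ) = ψ_τ(ρ⁻¹ ∘ σ) = (ρψ_τ)(σ)`»). [cite: Milne1999, §2 p. 54 L41–L42] -/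
theorem psiGal_smul (σ : cmNumbers ≃ₐ[ℚ] cmNumbers) (τ : K →ₐ[ℚ] cmNumbers) :
    psiGal hΦ (σ • τ) = σ • psiGal hΦ τ :=
  Subtype.ext (by rw [GalCMType.coe_smul, coe_psiGal, coe_psiGal, psiType_smul])

/-- «as `τ` runs over the embeddings `E ↪ ℚ^{al}`, `ψ_τ` runs over a `Γ`-orbit»: `ψ_τ ∈ Γ • ψ_ρ`.
[cite: Milne1999, §2 p. 54 L41–L42] -/
theorem psiGal_mem_orbit (ρ τ : K →ₐ[ℚ] cmNumbers) :
    psiGal hΦ τ ∈ MulAction.orbit (cmNumbers ≃ₐ[ℚ] cmNumbers) (psiGal hΦ ρ) := by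
  obtain ⟨σ, rfl⟩ := exists_algEquiv_smul_eq ρ τ
  rw [psiGal_smul]
  exact MulAction.mem_orbit _ σ

omit [FiniteDimensional ℚ K] in
/-- **«`Γ_ψ` is the group fixing `ψ`» = the group fixing `ρ(E)`**: for a PRIMITIVE pair, the stabiliser of `ψ_ρ` in
`Γ` is the stabiliser of the embedding `ρ` (`= Gal(ℚ^{cm}/ρ(E))`, `stabilizer_algHom_eq_fixingSubgroup`), so that
«`Hom(E_ψ, ℚ^{al}) = Γ/Γ_ψ`». [cite: Milne1999, §2 p. 56 L19–L21] -/
theorem stabilizer_psiType_eq {ρ : K →ₐ[ℚ] cmNumbers} (hP : IsPrimitive (cmNumbers ≃ₐ[ℚ] cmNumbers) Φ ρ) :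
    MulAction.stabilizer (cmNumbers ≃ₐ[ℚ] cmNumbers) (psiType Φ ρ) =
      MulAction.stabilizer (cmNumbers ≃ₐ[ℚ] cmNumbers) ρ := by
  rw [psiType_eq_reflexLift]
  exact hP.stabilizer_reflexLift_eq

omit [FiniteDimensional ℚ K] in
/-- **`τ ↦ ψ_τ` is injective for a primitive pair** (if `ψ_{στ} = σψ_τ = ψ_τ` then `σ ∈ Γ_ψ = Stab(τ)`; primitivity does
not depend on the base embedding, `isPrimitive_smul_iff`). [cite: Milne1999, §2 p. 56 L19–L21] -/
theorem psiType_injective {ρ : K →ₐ[ℚ] cmNumbers} (hP : IsPrimitive (cmNumbers ≃ₐ[ℚ] cmNumbers) Φ ρ) :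
    Function.Injective (psiType Φ : (K →ₐ[ℚ] cmNumbers) → Set (cmNumbers ≃ₐ[ℚ] cmNumbers)) := by
  intro τ τ' h
  obtain ⟨σ, rfl⟩ := exists_algEquiv_smul_eq ρ τ
  obtain ⟨σ', rfl⟩ := exists_algEquiv_smul_eq (σ • ρ) τ'
  have hP' : IsPrimitive (cmNumbers ≃ₐ[ℚ] cmNumbers) Φ (σ • ρ) := (isPrimitive_smul_iff Φ ρ σ).mpr hP
  have hσ' : σ' ∈ MulAction.stabilizer (cmNumbers ≃ₐ[ℚ] cmNumbers) (psiType Φ (σ • ρ)) := by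
    rw [MulAction.mem_stabilizer_iff, ← psiType_smul, ← h]
  rw [stabilizer_psiType_eq hP'] at hσ'
  exact (MulAction.mem_stabilizer_iff.mp hσ').symm

/-- **«`σ ↦ σψ` is a bijection from `Γ/Γ_ψ = Hom(E_ψ, ℚ^{al})` onto `Ψ`»**: for a primitive CM-pair `(E, Φ, ρ)` valued in
`ℚ^{cm}`, `τ ↦ ψ_τ` is a bijection `Hom_ℚ(E, ℚ^{cm}) ≃ Ψ = Γ • ψ_ρ`. [cite: Milne1999, §2 p. 56 L19–L21] -/
def homEquivOrbit {ρ : K →ₐ[ℚ] cmNumbers} (hP : IsPrimitive (cmNumbers ≃ₐ[ℚ] cmNumbers) Φ ρ) :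
    (K →ₐ[ℚ] cmNumbers) ≃ MulAction.orbit (cmNumbers ≃ₐ[ℚ] cmNumbers) (psiGal hΦ ρ) :=
  Equiv.ofBijective (fun τ ↦ ⟨psiGal hΦ τ, psiGal_mem_orbit hΦ ρ τ⟩)
    ⟨fun τ τ' h ↦ psiType_injective hP (congrArg (fun x ↦ x.1.1) h), fun ⟨ψ, hψ⟩ ↦ by
      obtain ⟨σ, rfl⟩ := hψ
      exact ⟨σ • ρ, Subtype.ext (psiGal_smul hΦ σ ρ)⟩⟩

/-- [cite: Milne1999, §2 p. 56 L19–L21] -/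
@[simp] theorem coe_homEquivOrbit_apply {ρ : K →ₐ[ℚ] cmNumbers} (hP : IsPrimitive (cmNumbers ≃ₐ[ℚ] cmNumbers) Φ ρ)
    (τ : K →ₐ[ℚ] cmNumbers) :
    ((homEquivOrbit hΦ hP τ : MulAction.orbit (cmNumbers ≃ₐ[ℚ] cmNumbers) (psiGal hΦ ρ)) : GalCMType) = psiGal hΦ τ :=
  rfl

/-- The bijection is `Γ`-equivariant. [cite: Milne1999, §2 p. 56 L19–L21] -/
theorem homEquivOrbit_smul {ρ : K →ₐ[ℚ] cmNumbers} (hP : IsPrimitive (cmNumbers ≃ₐ[ℚ] cmNumbers) Φ ρ)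
    (σ : cmNumbers ≃ₐ[ℚ] cmNumbers)
    (τ : K →ₐ[ℚ] cmNumbers) : homEquivOrbit hΦ hP (σ • τ) = σ • homEquivOrbit hΦ hP τ :=
  Subtype.ext (by rw [coe_homEquivOrbit_apply, MulAction.orbit.coe_smul, coe_homEquivOrbit_apply, psiGal_smul])

/-- The base embedding goes to the base point: `ρ ↦ ψ_ρ`. [cite: Milne1999, §2 p. 56 L19–L21] -/
theorem homEquivOrbit_base {ρ : K →ₐ[ℚ] cmNumbers} (hP : IsPrimitive (cmNumbers ≃ₐ[ℚ] cmNumbers) Φ ρ) :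
    homEquivOrbit hΦ hP ρ = ⟨psiGal hΦ ρ, MulAction.mem_orbit_self _⟩ :=
  rfl

variable (K) in
/-- **`X*(L(A_Ψ))` as printed**: «the quotient of `ℤ^{Hom(E_ψ, ℚ^{al})}` by the subgroup of `f` such that
`f(τ) = f(ιτ)` for all `τ` and `Σ f(τ) = 0`» — the character module of the `Γ`-set `Hom_ℚ(E, ℚ^{cm})` (composition
action) with `ι = cmNumbersConj`. [cite: Milne1999, §2 p. 56 L14–L19] -/
abbrev homCharModule : Type _ :=
  OrbitTorus.CharModule R (K →ₐ[ℚ] cmNumbers) cmNumbersConj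

variable (K) in
/-- Its `Γ`-module structure. [cite: Milne1999, §2 p. 56 L14–L19] -/
def homRep : Representation R (cmNumbers ≃ₐ[ℚ] cmNumbers) (homCharModule R K) :=
  OrbitTorus.rep R _ cmNumbersConj cmNumbersConj_mul_comm

/-- **«`l(A_Ψ)` is represented by `ι + 1`»**: the class of `δ_ρ + δ_{ιρ}` (the character `α ↦ ρ(α) · ρ(ια) = α · ια`).
[cite: Milne1999, §2 p. 56 L14–L19] -/
def lChar (ρ : K →ₐ[ℚ] cmNumbers) : homCharModule R K :=
  OrbitTorus.tChar R cmNumbersConj ρ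

omit [FiniteDimensional ℚ K] in
/-- `l` does not depend on the embedding used to write it. [cite: Milne1999, §2 p. 56 L14–L19] -/
theorem lChar_eq (ρ τ : K →ₐ[ℚ] cmNumbers) : lChar R ρ = lChar R τ :=
  OrbitTorus.tChar_eq R cmNumbersConj cmNumbersConj_mul_self ρ τ

omit [FiniteDimensional ℚ K] in
/-- `l` is `Γ`-invariant (a character defined over `ℚ`). [cite: Milne1999, §2 p. 56 L14–L19] -/
theorem homRep_lChar (σ : cmNumbers ≃ₐ[ℚ] cmNumbers) (ρ : K →ₐ[ℚ] cmNumbers) :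
    homRep R K σ (lChar R ρ) = lChar R ρ :=
  OrbitTorus.rep_tChar R cmNumbersConj cmNumbersConj_mul_comm cmNumbersConj_mul_self σ ρ

/-- **«This map identifies `X*(L(A_Ψ))` with `X*(T^Ψ)` …»**: transport of the character modules along
`homEquivOrbit : Hom_ℚ(E, ℚ^{cm}) ≃ Ψ`. [cite: Milne1999, §2 p. 56 L19–L22] -/
def homCharModuleEquiv {ρ : K →ₐ[ℚ] cmNumbers} (hP : IsPrimitive (cmNumbers ≃ₐ[ℚ] cmNumbers) Φ ρ) :
    homCharModule R K ≃ₗ[R] torusChar R (psiGal hΦ ρ) :=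
  OrbitTorus.congr R cmNumbersConj (homEquivOrbit hΦ hP) (homEquivOrbit_smul hΦ hP)

/-- **«… and `l(A_Ψ)` with `t^Ψ`.»** [cite: Milne1999, §2 p. 56 L19–L22] -/
theorem homCharModuleEquiv_lChar {ρ : K →ₐ[ℚ] cmNumbers} (hP : IsPrimitive (cmNumbers ≃ₐ[ℚ] cmNumbers) Φ ρ) :
    homCharModuleEquiv R hΦ hP (lChar R ρ) = tTorus R (psiGal hΦ ρ) := by
  rw [lChar, homCharModuleEquiv, OrbitTorus.congr_tChar, homEquivOrbit_base]
  rfl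

/-- The identification is `Γ`-equivariant. [cite: Milne1999, §2 p. 56 L19–L22] -/
theorem homCharModuleEquiv_rep {ρ : K →ₐ[ℚ] cmNumbers} (hP : IsPrimitive (cmNumbers ≃ₐ[ℚ] cmNumbers) Φ ρ)
    (σ : cmNumbers ≃ₐ[ℚ] cmNumbers) (x : homCharModule R K) :
    homCharModuleEquiv R hΦ hP (homRep R K σ x) = torusRep R (psiGal hΦ ρ) σ (homCharModuleEquiv R hΦ hP x) :=
  OrbitTorus.congr_rep R cmNumbersConj (homEquivOrbit hΦ hP) (homEquivOrbit_smul hΦ hP) cmNumbersConj_mul_comm σ x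

end Primitive

end CMNumbers

end Literature.NumberTheory.ComplexMultiplication

end
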